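import Literature.AlgebraicGeometry.Morphisms.SectionsFpqcDescentChart
import Literature.AlgebraicGeometry.Morphisms.DirectImageTowardsNormal
import HarnessLib

/-!
# Sections of a quasi-coherent module form an fpqc sheaf, II: `Γ(V, M) = eq(Γ(g⁻¹V, g^*M) ⇉ Γ(U₂, (p₁ ≫ g)^*M))`

Topic `Literature/AlgebraicGeometry/Morphisms`, namespace `Literature.AlgebraicGeometry.Morphisms`.  THEOREMS ONLY; no definition, no
named fact, no instance, no notation, no `sorry`.

[SGA1] Exp. VIII Thm. 1.1, Cor. 1.2 / [StacksProject, Tag 023M] / [GortzWedhorn2020] Thm. 14.66, for `g : Z → X` AFFINE, flat and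
surjective (e.g. the base change `B ×_S S′ → B` of a faithfully flat morphism of affine schemes `S′ → S` — the case the dual-pair descent of
cell `hodgecm-mathlib` needs), a kernel pair `p₁, p₂ : Z₂ ⇉ Z` given by ANY cartesian square `IsPullback p₁ p₂ g g`, a quasi-coherent
`𝒪_X`-module `M` and ANY open `V ⊆ X` (`U₂ = p₁⁻¹g⁻¹V ∩ p₂⁻¹g⁻¹V`):

* **`unitSection_injective`** — `η : Γ(V, M) → Γ(g⁻¹V, g^*M)` is injective;
* **`existsUnique_unitSection_eq`** — a section `s` of `g^*M` over `g⁻¹V` whose two cofaces `p₁^*s|_{U₂} = p₂^*s|_{U₂}` agree is `η(m)`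
  for a unique `m ∈ Γ(V, M)`;
* **`mem_range_unitSection_iff`** — the range form: `s ∈ range η ↔` the cofaces agree (exactness of
  `0 → Γ(V, M) → Γ(g⁻¹V, g^*M) ⇉ Γ(U₂, (p₁ ≫ g)^*M)`).

Proof: the chart statements of `Morphisms/SectionsFpqcDescentChart` on the affine opens `W ⊆ V` (which cover `V`, ★
`le_iSup_affineOpens_le`; `g⁻¹W` and `U₂(W) = p₁⁻¹g⁻¹W` are affine as `g` and its base change `p₁` are affine), sheaf gluing in `M`
(Mathlib `TopCat.Sheaf.existsUnique_gluing'`) and locality in `g^*M`.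
-- TODO(general form): `g` fpqc (faithfully flat and quasi-compact, or an fpqc covering family), not necessarily affine.

HC_CM is proved only modulo the 7 printed citations until rung 0 closes; nothing here is about HC.

## References
* [SGA1] A. Grothendieck, *SGA 1*, Exp. VIII §1, Thm. 1.1, Cor. 1.2.
* [StacksProject] The Stacks Project, Tag 023M (Descent, Lemma 35.3.6).
* [GortzWedhorn2020] U. Görtz, T. Wedhorn, *Algebraic Geometry I*, 2nd ed. (2020), Thm. 14.66.
-/

noncomputable section

-- `TopCat.Presheaf`/`Scheme.Modules` are not reducible (as in Mathlib's `AlgebraicGeometry/Modules`).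
set_option backward.isDefEq.respectTransparency false

universe u

open CategoryTheory CategoryTheory.Limits AlgebraicGeometry TopologicalSpace Opposite

namespace Literature.AlgebraicGeometry.Morphisms

open Literature.AlgebraicGeometry.Modules

variable {X Z Z₂ : Scheme.{u}} (g : Z ⟶ X) (p₁ p₂ : Z₂ ⟶ Z) (M : X.Modules)

/-! ### Gluing over the affine opens of `X` -/

section Global

variable (V : X.Opens)

/-- **`η : Γ(V, M) → Γ(g⁻¹V, g^*M)` is injective** for `g` affine, flat and surjective, `M` quasi-coherent and ANY open `V ⊆ X`
(injective on the affine opens below `V`, `unitSection_injective_of_affine`; sheaf locality on `M`).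
[cite: SGA1, Exp. VIII Thm. 1.1] [cite: StacksProject, Tag 023M] -/
theorem unitSection_injective [IsAffineHom g] [Flat g] [Surjective g] [M.IsQuasicoherent] :
    Function.Injective (unitSection g M V) := by
  intro m m' h
  refine TopCat.Sheaf.eq_of_locally_eq' (⟨M.presheaf, M.isSheaf⟩ : TopCat.Sheaf Ab X)
    (fun W : {W : X.affineOpens // (W : X.Opens) ≤ V} => (W.1 : X.Opens)) V (fun W => homOfLE W.2)
    (le_iSup_affineOpens_le V) m m' fun W => ?_
  change M.presheaf.map (homOfLE W.2).op m = M.presheaf.map (homOfLE W.2).op m'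
  apply unitSection_injective_of_affine g M W.1.2 (W.1.2.preimage g)
  rw [unitSection_map, unitSection_map, h]

/-- **Sections of a quasi-coherent module form an fpqc sheaf (equaliser exactness in the middle).**  Let `g : Z → X` be affine, flat
and surjective, `p₁, p₂ : Z₂ ⇉ Z` a kernel pair (`IsPullback p₁ p₂ g g`), `M` a quasi-coherent `𝒪_X`-module and `V ⊆ X` any open.  A
section `s ∈ Γ(g⁻¹V, g^*M)` whose two cofaces `p₁^*s|_{U₂}`, `p₂^*s|_{U₂} ∈ Γ(U₂, (p₁ ≫ g)^*M)` (`U₂ = p₁⁻¹g⁻¹V ∩ p₂⁻¹g⁻¹V`; the second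
read through `pullbackCongr`) agree is `η(m)` for a UNIQUE `m ∈ Γ(V, M)`: on each affine `W ⊆ V` the chart statement
`existsUnique_unitSection_eq_of_affine` (the cofaces commute with restriction, `cofaceFst_map`/`cofaceSnd_map`; `g⁻¹W` and
`U₂(W) = p₁⁻¹g⁻¹W` are affine as `g`, `p₁` are affine), the local solutions agree on overlaps by `unitSection_injective`, and glue in the
sheaf `M` (Mathlib `TopCat.Sheaf.existsUnique_gluing'`); the glued section maps to `s` by locality in `g^*M`.
[cite: SGA1, Exp. VIII Thm. 1.1, Cor. 1.2] [cite: StacksProject, Tag 023M] [cite: GortzWedhorn2020, Thm. 14.66]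
-- TODO(general form): `g` fpqc (faithfully flat, quasi-compact — or any fpqc covering family), not necessarily affine. -/
theorem existsUnique_unitSection_eq [IsAffineHom g] [Flat g] [Surjective g] [M.IsQuasicoherent] (H₂ : IsPullback p₁ p₂ g g)
    (s : Γ((Scheme.Modules.pullback g).obj M, g ⁻¹ᵁ V))
    (hs : ((Scheme.Modules.pullback (p₁ ≫ g)).obj M).presheaf.map
        (homOfLE (inf_le_left : p₁ ⁻¹ᵁ (g ⁻¹ᵁ V) ⊓ p₂ ⁻¹ᵁ (g ⁻¹ᵁ V) ≤ p₁ ⁻¹ᵁ (g ⁻¹ᵁ V))).op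
        (((Scheme.Modules.pullbackComp p₁ g).hom.app M).app (p₁ ⁻¹ᵁ (g ⁻¹ᵁ V))
          (unitSection p₁ ((Scheme.Modules.pullback g).obj M) (g ⁻¹ᵁ V) s)) =
      ((Scheme.Modules.pullback (p₁ ≫ g)).obj M).presheaf.map
        (homOfLE (inf_le_right : p₁ ⁻¹ᵁ (g ⁻¹ᵁ V) ⊓ p₂ ⁻¹ᵁ (g ⁻¹ᵁ V) ≤ p₂ ⁻¹ᵁ (g ⁻¹ᵁ V))).op
        (((Scheme.Modules.pullbackCongr H₂.w.symm).hom.app M).app (p₂ ⁻¹ᵁ (g ⁻¹ᵁ V))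
          (((Scheme.Modules.pullbackComp p₂ g).hom.app M).app (p₂ ⁻¹ᵁ (g ⁻¹ᵁ V))
            (unitSection p₂ ((Scheme.Modules.pullback g).obj M) (g ⁻¹ᵁ V) s)))) :
    ∃! m : Γ(M, V), unitSection g M V m = s := by
  haveI : IsAffineHom p₁ := MorphismProperty.of_isPullback H₂.flip inferInstance
  -- the affine opens `W ⊆ V`; `g⁻¹W` and `U₂(W) = p₁⁻¹g⁻¹W` are affine
  have hU : ∀ i : {W : X.affineOpens // (W : X.Opens) ≤ V}, IsAffineOpen (g ⁻¹ᵁ (i.1 : X.Opens)) := fun i => i.1.2.preimage g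
  have hU₂ : ∀ i : {W : X.affineOpens // (W : X.Opens) ≤ V},
      IsAffineOpen (p₁ ⁻¹ᵁ (g ⁻¹ᵁ (i.1 : X.Opens)) ⊓ p₂ ⁻¹ᵁ (g ⁻¹ᵁ (i.1 : X.Opens))) := fun i => by
    have h12 : p₁ ⁻¹ᵁ (g ⁻¹ᵁ (i.1 : X.Opens)) = p₂ ⁻¹ᵁ (g ⁻¹ᵁ (i.1 : X.Opens)) := by
      change (p₁ ≫ g) ⁻¹ᵁ (i.1 : X.Opens) = (p₂ ≫ g) ⁻¹ᵁ (i.1 : X.Opens)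
      rw [H₂.w]
    rw [inf_eq_left.mpr h12.le]
    exact (hU i).preimage p₁
  -- local solutions on the affine opens below `V`
  have hloc : ∀ i : {W : X.affineOpens // (W : X.Opens) ≤ V}, ∃ m : Γ(M, (i.1 : X.Opens)),
      unitSection g M i.1 m = ((Scheme.Modules.pullback g).obj M).presheaf.map (homOfLE (g.preimage_mono i.2)).op s := fun i =>
    (existsUnique_unitSection_eq_of_affine g p₁ p₂ M H₂ i.1.2 (hU i) (hU₂ i) _
      (by rw [cofaceFst_map g p₁ p₂ M i.2 s, cofaceSnd_map g p₁ p₂ M H₂.w.symm i.2 s, hs])).exists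
  choose mloc hmloc using hloc
  -- they agree on overlaps (`η` is injective over `Wᵢ ∩ Wⱼ`)
  have hcompat : ∀ i j : {W : X.affineOpens // (W : X.Opens) ≤ V},
      M.presheaf.map (homOfLE (inf_le_left : (i.1 : X.Opens) ⊓ j.1 ≤ i.1)).op (mloc i) =
        M.presheaf.map (homOfLE (inf_le_right : (i.1 : X.Opens) ⊓ j.1 ≤ j.1)).op (mloc j) := by
    intro i j
    apply unitSection_injective g M
    rw [unitSection_map, unitSection_map, hmloc, hmloc, ← CategoryTheory.comp_apply, ← Functor.map_comp,
      ← CategoryTheory.comp_apply, ← Functor.map_comp]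
    exact presheaf_map_congr _ _ _ _
  -- glue in `M`
  obtain ⟨m, hm, -⟩ := TopCat.Sheaf.existsUnique_gluing' (⟨M.presheaf, M.isSheaf⟩ : TopCat.Sheaf Ab X)
    (fun W : {W : X.affineOpens // (W : X.Opens) ≤ V} => (W.1 : X.Opens)) V (fun W => homOfLE W.2)
    (le_iSup_affineOpens_le V) mloc hcompat
  have hm' : ∀ i : {W : X.affineOpens // (W : X.Opens) ≤ V}, M.presheaf.map (homOfLE i.2).op m = mloc i := hm
  -- `η(m) = s`, by locality in `g^*M` along the cover `g⁻¹Wᵢ` of `g⁻¹V`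
  have hms : unitSection g M V m = s := by
    refine TopCat.Sheaf.eq_of_locally_eq'
      (⟨((Scheme.Modules.pullback g).obj M).presheaf, ((Scheme.Modules.pullback g).obj M).isSheaf⟩ : TopCat.Sheaf Ab Z)
      (fun W : {W : X.affineOpens // (W : X.Opens) ≤ V} => g ⁻¹ᵁ (W.1 : X.Opens)) (g ⁻¹ᵁ V)
      (fun W => homOfLE (g.preimage_mono W.2)) ?_ _ _ fun i => ?_
    · rw [← Scheme.Hom.preimage_iSup]
      exact g.preimage_mono (le_iSup_affineOpens_le V)
    · change ((Scheme.Modules.pullback g).obj M).presheaf.map (homOfLE (g.preimage_mono i.2)).op (unitSection g M V m) =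
        ((Scheme.Modules.pullback g).obj M).presheaf.map (homOfLE (g.preimage_mono i.2)).op s
      rw [← hmloc i, ← hm' i, unitSection_map]
      exact presheaf_map_congr _ _ _ _
  exact ⟨m, hms, fun m' hm'' => unitSection_injective g M V (hm''.trans hms.symm)⟩

/-- **`Γ(V, M) = eq(Γ(g⁻¹V, g^*M) ⇉ Γ(U₂, (p₁ ≫ g)^*M))`, as a range statement**: a section of `g^*M` over `g⁻¹V` is pulled back from
`V` iff its two cofaces agree (`cofaceFst_unitSection`/`cofaceSnd_unitSection` and `existsUnique_unitSection_eq`); with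
`unitSection_injective` this is the exactness of `0 → Γ(V, M) → Γ(g⁻¹V, g^*M) ⇉ Γ(U₂, (p₁ ≫ g)^*M)`.
[cite: SGA1, Exp. VIII Thm. 1.1, Cor. 1.2] [cite: StacksProject, Tag 023M] [cite: GortzWedhorn2020, Thm. 14.66] -/
theorem mem_range_unitSection_iff [IsAffineHom g] [Flat g] [Surjective g] [M.IsQuasicoherent] (H₂ : IsPullback p₁ p₂ g g)
    (s : Γ((Scheme.Modules.pullback g).obj M, g ⁻¹ᵁ V)) :
    s ∈ Set.range (unitSection g M V) ↔
      ((Scheme.Modules.pullback (p₁ ≫ g)).obj M).presheaf.map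
        (homOfLE (inf_le_left : p₁ ⁻¹ᵁ (g ⁻¹ᵁ V) ⊓ p₂ ⁻¹ᵁ (g ⁻¹ᵁ V) ≤ p₁ ⁻¹ᵁ (g ⁻¹ᵁ V))).op
        (((Scheme.Modules.pullbackComp p₁ g).hom.app M).app (p₁ ⁻¹ᵁ (g ⁻¹ᵁ V))
          (unitSection p₁ ((Scheme.Modules.pullback g).obj M) (g ⁻¹ᵁ V) s)) =
      ((Scheme.Modules.pullback (p₁ ≫ g)).obj M).presheaf.map
        (homOfLE (inf_le_right : p₁ ⁻¹ᵁ (g ⁻¹ᵁ V) ⊓ p₂ ⁻¹ᵁ (g ⁻¹ᵁ V) ≤ p₂ ⁻¹ᵁ (g ⁻¹ᵁ V))).op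
        (((Scheme.Modules.pullbackCongr H₂.w.symm).hom.app M).app (p₂ ⁻¹ᵁ (g ⁻¹ᵁ V))
          (((Scheme.Modules.pullbackComp p₂ g).hom.app M).app (p₂ ⁻¹ᵁ (g ⁻¹ᵁ V))
            (unitSection p₂ ((Scheme.Modules.pullback g).obj M) (g ⁻¹ᵁ V) s))) := by
  constructor
  · rintro ⟨m, rfl⟩
    rw [cofaceFst_unitSection, cofaceSnd_unitSection]
  · intro hs
    obtain ⟨m, hm, -⟩ := existsUnique_unitSection_eq g p₁ p₂ M V H₂ s hs
    exact ⟨m, hm⟩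

end Global

end Literature.AlgebraicGeometry.Morphisms

end
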